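import Mathlib
import Literature.NumberTheory.LFunctions.Zhang2022.Section16BlockAClosers
import Literature.NumberTheory.LFunctions.Zhang2022.Section16Eq1616R2Weak
import Literature.NumberTheory.LFunctions.Zhang2022.Section16BUnsmoothing
import Literature.NumberTheory.LFunctions.Zhang2022.Section16BSmoothedSum
import Literature.NumberTheory.LFunctions.Zhang2022.TypedSection16BLemma162Rp
import HarnessLib

/-!
# Zhang (2022) §16 (16.16): the two-piece `h16_16` plug with the `𝔫(𝔮)`-removal DISCHARGED —
# `Eq16_16R2E e1pp c′ ⇐ {Eq16_15E e1pp c′, Step16_u041aR c′, Lemma162Rq c′}`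

Topic `Literature/NumberTheory/LFunctions/Zhang2022` (Landau–Siegel audit tree; verdict-neutral).
Y. Zhang, *Discrete mean estimates and the Landau–Siegel zero*, arXiv:2211.02515v1 (2022)
[Zhang2022LandauSiegel] — **an unrefereed manuscript under adjudication**; nothing here bears on its
Theorems 1–2. ZHANG-L discharge lane (WP16, seat zl-w16-p4). zl-w16-ref-1's kernel-checked plug term
(STATUS 01:29:19Z) `eq16_16R2E_of_subleaves_rate4 e1pp c′ h15 hrem (step16_u040a_weak c′)
(step16_u040b_rate4_of c′ (step16_u040b_holds c′)) h41a (lemma162R_of_Rq c′ h162)` with the binder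
`hrem` now CLOSED by `inline16_nsetRemovableE_holds e1pp c′` (this seat's `Section16BlockAClosers`):
the remaining open binders of `h16_16` are exactly `h15 : Eq16_15E e1pp c′` (Block A tail),
`h41a : Step16_u041aR c′` (Block C), `h162 : Lemma162Rq c′` (Block D). Theorems only.

## References

* Y. Zhang, arXiv:2211.02515v1 (2022), §16 (16.15)–(16.16) p. 94. [cite: Zhang2022LandauSiegel, §16 (16.16) p.94]
-/

noncomputable section

open Complex Real
open Literature.NumberTheory.LFunctions.Zhang2022
open Literature.NumberTheory.LFunctions.Zhang2022.Skeleton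

namespace Literature.NumberTheory.LFunctions.Zhang2022.Typed.Section16B

/-- **`Eq16_16R2E e1pp c′` from the three remaining binders** `h15 : Eq16_15E e1pp c′`,
`h41a : Step16_u041aR c′`, `h162 : Lemma162Rq c′` (hrem, h40a, h40b discharged by
`inline16_nsetRemovableE_holds`, `step16_u040a_weak`, `step16_u040b_holds`).
[cite: Zhang2022LandauSiegel, §16 (16.16) p.94] -/
theorem eq16_16R2E_of_h15_h41a_h162 (e1pp : ℕ → ℂ) (c' : ℝ) (h15 : Eq16_15E e1pp c')
    (h41a : Step16_u041aR c') (h162 : Lemma162Rq c') : Eq16_16R2E e1pp c' :=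
  eq16_16R2E_of_subleaves_rate4 e1pp c' h15 (inline16_nsetRemovableE_holds e1pp c')
    (step16_u040a_weak c') (step16_u040b_rate4_of c' (step16_u040b_holds c')) h41a
    (lemma162R_of_Rq c' h162)

/-- **Printed-constant form**: `Eq16_16R2 c′ ⇐ {Eq16_15 c′, Step16_u041aR c′, Lemma162Rq c′}` (the
E-twin at `e1ppj` through the `rfl` bridges `eq16_15E_e1ppj`, `eq16_16R2E_e1ppj`).
[cite: Zhang2022LandauSiegel, §16 (16.16) p.94] -/
theorem eq16_16R2_of_h15_h41a_h162 (c' : ℝ) (h15 : Eq16_15 c') (h41a : Step16_u041aR c')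
    (h162 : Lemma162Rq c') : Eq16_16R2 c' := by
  rw [← eq16_16R2E_e1ppj]
  exact eq16_16R2E_of_h15_h41a_h162 e1ppj c' (by rw [eq16_15E_e1ppj]; exact h15) h41a h162

end Literature.NumberTheory.LFunctions.Zhang2022.Typed.Section16B

end
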